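import Summits.QuantumFields.YangMills.Theorems.UnitScaleTiltProp7FrameMassStep
import Summits.QuantumFields.YangMills.Theorems.UnitScaleTiltProp7GaugeTwistLogRatio
import Literature.MathematicalPhysics.QuantumFieldTheory.Balaban1983to89.B11Eq98V0LettersFlat
import HarnessLib

/-!
# Route `UnitScaleTilt`, crux K1 «MinimiserStabilityRegPr» (stmt-QuantumFields-19200), route-R E′ (A′) «HCOW-VIA-Σ», row P-A2 «JOINT-Σ», file F3″-C1 —
# THE TWISTED LINK THROUGH THE PLAIN TOWER AND THE SUP STEP OF THE ACCUMULATED FRAMES (generic level, every input displayed):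
# `Σ_b ‖V^{(l)}(b)·Ū₀^{(l)}(b)⁻¹ − 1‖² ≤ 3·(Σ_b ‖Ū^{(l)}(b)·Ū₀^{(l)}(b)⁻¹ − 1‖² + 2d·Σ_x ‖v_l(x) − 1‖²)` and `‖v_{k+1}(y) − 1‖ ≤ ρ + δ + 6(ρ + 3δ)²`

Cell `ym3-torus`, width seat `ym3-torus-px17` (gen 3); px22 g3 ■ FINAL «F3″-C is the one pen left» ∕ LOCATE `LOCATE-PA2-F3C-T3KNIT-px17g3.md` (19200 evidence #50).  THE POINT.  By (97)
(✓ `Prop7SymAvgTwSym.dbarCovIterU_eq_gaugeActT_frameAccU`) the covariant double-bar tower is the plain tower in the accumulated frames, `V^{(l)}(b) = v_l(b₋)⁻¹·Ū^{(l)}(b)·v_l(b₊)`;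
hence the twisted link relative to the background tower splits as `V Ū₀⁻¹ − 1 = (v₋⁻¹ − 1)·R·a + (R − 1)·a + (a − 1)` with `R = Ū(b)Ū₀(b)⁻¹` the SINGLE-BAR ratio (whose `ℓ²` mass
is (n3)'s ✓ `Prop7FibreLevelMassPerLevelT3.sum_normSq_levelRatio_le_LOnly_T3`) and `a = Ū₀(b)·v_l(b₊)·Ū₀(b)⁻¹` a conjugated frame — §1 gives the `hMtw` row of ✓ `Prop7TwistedLevelMassInduction.
twistedMass_le` (`M^{tw} ≤ 3(M^{sb} + 2d·Φ)`, counts ✓ `Prop7GaugeTwistLogRatio.sum_pbond_src∕_tgt`).  §2 is the SUP twin of ✓ `Prop7AccumulatedFrameStep.norm_frameAccU_succ_sub_one_le`: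
with every frame within `δ` and every single-bar stair ratio within `ρ` of `1`, `‖v_{k+1}(y) − 1‖ ≤ ρ + δ + 6(ρ + 3δ)²` — it does not contract, but (§3) with a geometrically GROWING source
`2ρ_k ≤ ρ_{k+1}`, `294ρ_k ≤ 1` the invariant `δ_k ≤ 2ρ_k` survives one step, so at T³ (where (n3)'s `hμθ` makes the sources geometric) the per-level frame sup window of
✓ `Prop7FrameMassStep.frameMass_step_le` is DERIVED, not displayed (the T³ knit is the sibling file F3″-C2).  THEOREMS ONLY (0 `def`, 0 `sorry`); `--supports stmt-QuantumFields-19200`, count-neutral.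
YM₃ on T³ is a ladder rung (R3), not the Clay problem; nothing here claims the stub, the crux, d = 4 or the gap.

References: T. Bałaban, CMP 98 (1985) 17–51 [Balaban1985Averaging] ((58) p.27, (82) p.30, (89) p.31, (97) p.32, Prop. 3 (122)–(126) p.36); CMP 95 (1984) 17–40 [Balaban1984PropagatorsI] ((1.18)–(1.20) pp.19–20).
-/

set_option autoImplicit false

noncomputable section

open scoped BigOperators

namespace Summit.QuantumFields.YangMills.Theorems.Prop7TwistedLinkFrameSup

open Finset
open Literature.MathematicalPhysics.QuantumFieldTheory.Balaban1983to89
open T4Continuum T4ReflectionCone BlockAveraging AveragingRT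
open B10Eq27TorusAxialLog (holT transl gaugeActT gaugeActT_apply)
open B7Prop1Explicit (disp)
open Summit.QuantumFields.YangMills.Theorems.Prop8Chart (emlIterU)
open Summit.QuantumFields.YangMills.Theorems.Prop7SymAvgTwSym (tstairU frameAccU dbarCovIterU dbarCovIterU_eq_gaugeActT_frameAccU)
open Summit.QuantumFields.YangMills.Theorems.Prop7AccumulatedFrameStep (norm_frameAccU_succ_sub_one_le tstairU_eq_frame_inv_mul norm_inv_mul_sub_one_le)
open Summit.QuantumFields.YangMills.Theorems.Prop7FrameMassStep (norm_conj_sub_one_le norm_conj_le_one)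
open Summit.QuantumFields.YangMills.Theorems.Prop7GaugeTwistLogRatio (sum_pbond_src sum_pbond_tgt)

variable {P : Params} {𝔸 : Type*} [NormedRing 𝔸] [NormedAlgebra ℂ 𝔸] [CompleteSpace 𝔸]

/-! ## §1 The twisted link through the plain tower ((97)) -/

/-- (97) at a bond: `V^{(l)}(b) = v_l(b₋)⁻¹ · Ū^{(l)}(b) · v_l(b₊)`. [cite: Balaban1985Averaging, (97) p.32, (89) p.31] -/
theorem dbarCovIterU_apply (l : ℕ) (U₀ W : GaugeField P 0 𝔸ˣ) (b : PBond P l) :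
    dbarCovIterU l U₀ W b = (frameAccU l U₀ W b.src)⁻¹ * emlIterU l W b * frameAccU l U₀ W b.tgt := by
  rw [dbarCovIterU_eq_gaugeActT_frameAccU U₀ W l, gaugeActT_apply, inv_inv]

/-- (97) relative to the background tower: `V(b)·Ū₀(b)⁻¹ = v(b₋)⁻¹ · [Ū(b)Ū₀(b)⁻¹] · [Ū₀(b)·v(b₊)·Ū₀(b)⁻¹]` (group algebra). [cite: Balaban1985Averaging, (97) p.32] -/
theorem dbarCovIterU_mul_inv_eq (l : ℕ) (U₀ W : GaugeField P 0 𝔸ˣ) (b : PBond P l) :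
    dbarCovIterU l U₀ W b * (emlIterU l U₀ b)⁻¹
      = (frameAccU l U₀ W b.src)⁻¹ * (emlIterU l W b * (emlIterU l U₀ b)⁻¹) * (emlIterU l U₀ b * frameAccU l U₀ W b.tgt * (emlIterU l U₀ b)⁻¹) := by
  rw [dbarCovIterU_apply]; group

omit [NormedAlgebra ℂ 𝔸] [CompleteSpace 𝔸] in
/-- the three-factor split `x·R·a − 1 = (x − 1)Ra + (R − 1)a + (a − 1)` in norms, for `‖R‖, ‖a‖ ≤ 1`. [folklore] -/
theorem norm_triple_sub_one_le (x R a : 𝔸) (hR : ‖R‖ ≤ 1) (ha : ‖a‖ ≤ 1) :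
    ‖x * R * a - 1‖ ≤ ‖x - 1‖ + ‖R - 1‖ + ‖a - 1‖ := by
  have e : x * R * a - 1 = (x - 1) * R * a + (R - 1) * a + (a - 1) := by noncomm_ring
  rw [e]
  refine (norm_add_le _ _).trans (add_le_add ((norm_add_le _ _).trans (add_le_add ?_ ?_)) le_rfl)
  · calc ‖(x - 1) * R * a‖ ≤ ‖x - 1‖ * ‖R‖ * ‖a‖ := (norm_mul_le _ _).trans (mul_le_mul_of_nonneg_right (norm_mul_le _ _) (norm_nonneg _))
      _ ≤ ‖x - 1‖ * 1 * 1 := by gcongr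
      _ = ‖x - 1‖ := by ring
  · calc ‖(R - 1) * a‖ ≤ ‖R - 1‖ * ‖a‖ := norm_mul_le _ _
      _ ≤ ‖R - 1‖ * 1 := by gcongr
      _ = ‖R - 1‖ := by ring

/-- ★★ **THE TWISTED LINK AGAINST THE BACKGROUND TOWER, POINTWISE**: with `v = frameAccU l U₀ W`, `Ū = emlIterU l W`, `Ū₀ = emlIterU l U₀` and the U1 rows displayed
(`‖v(b₋)⁻¹‖, ‖v(b₊)‖, ‖Ū(b)‖, ‖Ū₀(b)‖, ‖Ū₀(b)⁻¹‖ ≤ 1`):  `‖V^{(l)}(b)Ū₀(b)⁻¹ − 1‖ ≤ ‖v(b₋) − 1‖ + ‖Ū(b)Ū₀(b)⁻¹ − 1‖ + ‖v(b₊) − 1‖`.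
[cite: Balaban1985Averaging, (97) p.32, (89) p.31] -/
theorem norm_twistedLink_sub_one_le (l : ℕ) (U₀ W : GaugeField P 0 𝔸ˣ) (b : PBond P l)
    (hvs : ‖(((frameAccU l U₀ W b.src)⁻¹ : 𝔸ˣ) : 𝔸)‖ ≤ 1) (hvt : ‖(frameAccU l U₀ W b.tgt : 𝔸)‖ ≤ 1)
    (hW : ‖(emlIterU l W b : 𝔸)‖ ≤ 1) (hU : ‖(emlIterU l U₀ b : 𝔸)‖ ≤ 1) (hU' : ‖(((emlIterU l U₀ b)⁻¹ : 𝔸ˣ) : 𝔸)‖ ≤ 1) :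
    ‖((dbarCovIterU l U₀ W b * (emlIterU l U₀ b)⁻¹ : 𝔸ˣ) : 𝔸) - 1‖
      ≤ ‖(frameAccU l U₀ W b.src : 𝔸) - 1‖ + ‖((emlIterU l W b * (emlIterU l U₀ b)⁻¹ : 𝔸ˣ) : 𝔸) - 1‖ + ‖(frameAccU l U₀ W b.tgt : 𝔸) - 1‖ := by
  rw [dbarCovIterU_mul_inv_eq, Units.val_mul, Units.val_mul]
  have hR : ‖((emlIterU l W b * (emlIterU l U₀ b)⁻¹ : 𝔸ˣ) : 𝔸)‖ ≤ 1 := by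
    rw [Units.val_mul]
    exact (norm_mul_le _ _).trans (by nlinarith [norm_nonneg (emlIterU l W b : 𝔸), norm_nonneg (((emlIterU l U₀ b)⁻¹ : 𝔸ˣ) : 𝔸)])
  have ha : ‖((emlIterU l U₀ b * frameAccU l U₀ W b.tgt * (emlIterU l U₀ b)⁻¹ : 𝔸ˣ) : 𝔸)‖ ≤ 1 := norm_conj_le_one _ _ hU hU' hvt
  have ha1 : ‖((emlIterU l U₀ b * frameAccU l U₀ W b.tgt * (emlIterU l U₀ b)⁻¹ : 𝔸ˣ) : 𝔸) - 1‖ ≤ ‖(frameAccU l U₀ W b.tgt : 𝔸) - 1‖ :=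
    norm_conj_sub_one_le _ _ hU hU'
  have hx1 : ‖(((frameAccU l U₀ W b.src)⁻¹ : 𝔸ˣ) : 𝔸) - 1‖ ≤ ‖(frameAccU l U₀ W b.src : 𝔸) - 1‖ :=
    B11Eq98V0LettersFlat.norm_inv_sub_one_le _ hvs
  have h := norm_triple_sub_one_le (((frameAccU l U₀ W b.src)⁻¹ : 𝔸ˣ) : 𝔸) _ _ hR ha
  linarith

/-- ★★ **THE TWISTED LEVEL MASS AGAINST THE SINGLE-BAR MASS AND THE FRAME MASS** (`(a+b+c)² ≤ 3(a²+b²+c²)`, each site is the source of `d` and the target of `d` bonds):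
`Σ_b ‖V^{(l)}(b)Ū₀(b)⁻¹ − 1‖² ≤ 3·(Σ_b ‖Ū(b)Ū₀(b)⁻¹ − 1‖² + 2d·Σ_x ‖v_l(x) − 1‖²)` — the `hMtw` row of ✓ `Prop7TwistedLevelMassInduction.twistedMass_le`.
[cite: Balaban1985Averaging, (97) p.32, Prop. 3 (122)-(126) p.36] -/
theorem sum_normSq_twistedLink_le (l : ℕ) (U₀ W : GaugeField P 0 𝔸ˣ)
    (hv1 : ∀ x : Site P l, ‖(frameAccU l U₀ W x : 𝔸)‖ ≤ 1) (hv1' : ∀ x : Site P l, ‖(((frameAccU l U₀ W x)⁻¹ : 𝔸ˣ) : 𝔸)‖ ≤ 1)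
    (hW : ∀ b : PBond P l, ‖(emlIterU l W b : 𝔸)‖ ≤ 1) (hU : ∀ b : PBond P l, ‖(emlIterU l U₀ b : 𝔸)‖ ≤ 1)
    (hU' : ∀ b : PBond P l, ‖(((emlIterU l U₀ b)⁻¹ : 𝔸ˣ) : 𝔸)‖ ≤ 1) :
    ∑ b : PBond P l, ‖((dbarCovIterU l U₀ W b * (emlIterU l U₀ b)⁻¹ : 𝔸ˣ) : 𝔸) - 1‖ ^ 2
      ≤ 3 * (∑ b : PBond P l, ‖((emlIterU l W b * (emlIterU l U₀ b)⁻¹ : 𝔸ˣ) : 𝔸) - 1‖ ^ 2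
          + 2 * (P.d : ℝ) * ∑ x : Site P l, ‖(frameAccU l U₀ W x : 𝔸) - 1‖ ^ 2) := by
  have hpt : ∀ b : PBond P l, ‖((dbarCovIterU l U₀ W b * (emlIterU l U₀ b)⁻¹ : 𝔸ˣ) : 𝔸) - 1‖ ^ 2
      ≤ 3 * (‖((emlIterU l W b * (emlIterU l U₀ b)⁻¹ : 𝔸ˣ) : 𝔸) - 1‖ ^ 2 + ‖(frameAccU l U₀ W b.src : 𝔸) - 1‖ ^ 2 + ‖(frameAccU l U₀ W b.tgt : 𝔸) - 1‖ ^ 2) := by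
    intro b
    have h := norm_twistedLink_sub_one_le l U₀ W b (hv1' _) (hv1 _) (hW b) (hU b) (hU' b)
    have h0 : 0 ≤ ‖((dbarCovIterU l U₀ W b * (emlIterU l U₀ b)⁻¹ : 𝔸ˣ) : 𝔸) - 1‖ := norm_nonneg _
    have h3 : ∀ p q r : ℝ, (p + q + r) ^ 2 ≤ 3 * (q ^ 2 + p ^ 2 + r ^ 2) := fun p q r => by
      nlinarith [sq_nonneg (p - q), sq_nonneg (p - r), sq_nonneg (q - r)]
    exact (pow_le_pow_left₀ h0 h 2).trans (h3 _ _ _)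
  refine (Finset.sum_le_sum fun b _ => hpt b).trans (le_of_eq ?_)
  rw [← Finset.mul_sum, Finset.sum_add_distrib, Finset.sum_add_distrib,
    sum_pbond_src (fun x => ‖(frameAccU l U₀ W x : 𝔸) - 1‖ ^ 2), sum_pbond_tgt (fun x => ‖(frameAccU l U₀ W x : 𝔸) - 1‖ ^ 2)]
  ring

/-! ## §2 The sup step of the accumulated frames -/

/-- ★ **THE TWISTED STAIR TRANSPORTERS IN SUP**: with the U1 rows, `‖v_k − 1‖ ≤ δ ≤ ½` everywhere and every single-bar stair ratio `‖R_i(y) − 1‖ ≤ ρ`,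
`‖tstair_i(y) − 1‖ ≤ ρ + 3δ` (`tstair_i = v(y_c)⁻¹·R_i·a_i`, ✓ `tstairU_eq_frame_inv_mul`; `‖a_i − 1‖ ≤ ‖v(x_i) − 1‖`, `‖v⁻¹ − 1‖ ≤ 2‖v − 1‖`). [cite: Balaban1985Averaging, (58) p.27, (97) p.32] -/
theorem norm_tstairU_sub_one_le_sup (k : ℕ) (U₀ W : GaugeField P 0 𝔸ˣ) {δ ρ : ℝ} (hδ2 : δ ≤ 1 / 2)
    (hv1 : ∀ x : Site P k, ‖(frameAccU k U₀ W x : 𝔸)‖ ≤ 1)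
    (hv1' : ∀ x : Site P k, ‖(((frameAccU k U₀ W x)⁻¹ : 𝔸ˣ) : 𝔸)‖ ≤ 1)
    (hν : ∀ (y : Site P (k + 1)) (i : Idx P), ‖((holT (emlIterU k U₀) (emb y) (stairWord i.2.1 (off i.1)) : 𝔸ˣ) : 𝔸)‖ ≤ 1 ∧
      ‖(((holT (emlIterU k U₀) (emb y) (stairWord i.2.1 (off i.1)))⁻¹ : 𝔸ˣ) : 𝔸)‖ ≤ 1)
    (hv2 : ∀ x : Site P k, ‖(frameAccU k U₀ W x : 𝔸) - 1‖ ≤ δ)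
    (hR : ∀ (y : Site P (k + 1)) (i : Idx P),
      ‖((holT (emlIterU k W) (emb y) (stairWord i.2.1 (off i.1)) * (holT (emlIterU k U₀) (emb y) (stairWord i.2.1 (off i.1)))⁻¹ : 𝔸ˣ) : 𝔸) - 1‖ ≤ ρ)
    (y : Site P (k + 1)) (i : Idx P) :
    ‖((tstairU (emlIterU k U₀) (dbarCovIterU k U₀ W) y i : 𝔸ˣ) : 𝔸) - 1‖ ≤ ρ + 3 * δ := by
  rw [tstairU_eq_frame_inv_mul, Units.val_mul]
  refine (norm_inv_mul_sub_one_le _ (hv1' _) _).trans ?_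
  rw [Units.val_mul]
  have ha1 : ‖((holT (emlIterU k U₀) (emb y) (stairWord i.2.1 (off i.1)) * frameAccU k U₀ W (transl (emb y) (disp (stairWord i.2.1 (off i.1))))
          * (holT (emlIterU k U₀) (emb y) (stairWord i.2.1 (off i.1)))⁻¹ : 𝔸ˣ) : 𝔸) - 1‖ ≤ δ :=
    (norm_conj_sub_one_le _ _ (hν y i).1 (hν y i).2).trans (hv2 _)
  have ha : ‖((holT (emlIterU k U₀) (emb y) (stairWord i.2.1 (off i.1)) * frameAccU k U₀ W (transl (emb y) (disp (stairWord i.2.1 (off i.1))))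
          * (holT (emlIterU k U₀) (emb y) (stairWord i.2.1 (off i.1)))⁻¹ : 𝔸ˣ) : 𝔸)‖ ≤ 1 :=
    norm_conj_le_one _ _ (hν y i).1 (hν y i).2 (hv1 _)
  have h1 : ‖((holT (emlIterU k W) (emb y) (stairWord i.2.1 (off i.1)) * (holT (emlIterU k U₀) (emb y) (stairWord i.2.1 (off i.1)))⁻¹ : 𝔸ˣ) : 𝔸)
      * ((holT (emlIterU k U₀) (emb y) (stairWord i.2.1 (off i.1)) * frameAccU k U₀ W (transl (emb y) (disp (stairWord i.2.1 (off i.1))))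
        * (holT (emlIterU k U₀) (emb y) (stairWord i.2.1 (off i.1)))⁻¹ : 𝔸ˣ) : 𝔸) - 1‖ ≤ ρ + δ := by
    have e : ∀ R a : 𝔸, R * a - 1 = (R - 1) * a + (a - 1) := fun R a => by noncomm_ring
    rw [e]
    refine (norm_add_le _ _).trans (add_le_add ?_ ha1)
    exact (norm_mul_le _ _).trans ((mul_le_mul (hR y i) ha (norm_nonneg _) ((norm_nonneg _).trans (hR y i))).trans (le_of_eq (mul_one _)))
  have h2 : ‖(((frameAccU k U₀ W (emb y))⁻¹ : 𝔸ˣ) : 𝔸) - 1‖ ≤ 2 * δ :=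
    (B7Prop6Flat.norm_units_inv_sub_one_le _ ((hv2 _).trans hδ2)).trans (by linarith [hv2 (emb y)])
  linarith

/-- ★★★ **THE SUP STEP OF THE ACCUMULATED FRAMES**: with the U1 rows, `‖v_k − 1‖ ≤ δ` everywhere, every single-bar stair ratio within `ρ` of `1` and the window `ρ + 3δ ≤ ¼`
(`0 ≤ ρ`), for every coarse site `‖v_{k+1}(y) − 1‖ ≤ ρ + δ + 6(ρ + 3δ)²` (✓ `norm_frameAccU_succ_sub_one_le`: the centre frame cancels at first order; the mean of bounded terms is bounded).
[cite: Balaban1985Averaging, (82) p.30, (97) p.32, (26)-(27) p.22] -/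
theorem norm_frameAccU_succ_sub_one_le_sup (k : ℕ) (U₀ W : GaugeField P 0 𝔸ˣ) {δ ρ : ℝ} (hρ : 0 ≤ ρ) (ht : ρ + 3 * δ ≤ 1 / 4)
    (hv1 : ∀ x : Site P k, ‖(frameAccU k U₀ W x : 𝔸)‖ ≤ 1)
    (hv1' : ∀ x : Site P k, ‖(((frameAccU k U₀ W x)⁻¹ : 𝔸ˣ) : 𝔸)‖ ≤ 1)
    (hν : ∀ (y : Site P (k + 1)) (i : Idx P), ‖((holT (emlIterU k U₀) (emb y) (stairWord i.2.1 (off i.1)) : 𝔸ˣ) : 𝔸)‖ ≤ 1 ∧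
      ‖(((holT (emlIterU k U₀) (emb y) (stairWord i.2.1 (off i.1)))⁻¹ : 𝔸ˣ) : 𝔸)‖ ≤ 1)
    (hv2 : ∀ x : Site P k, ‖(frameAccU k U₀ W x : 𝔸) - 1‖ ≤ δ)
    (hR : ∀ (y : Site P (k + 1)) (i : Idx P),
      ‖((holT (emlIterU k W) (emb y) (stairWord i.2.1 (off i.1)) * (holT (emlIterU k U₀) (emb y) (stairWord i.2.1 (off i.1)))⁻¹ : 𝔸ˣ) : 𝔸) - 1‖ ≤ ρ)
    (y : Site P (k + 1)) :
    ‖(frameAccU (k + 1) U₀ W y : 𝔸) - 1‖ ≤ ρ + δ + 6 * (ρ + 3 * δ) ^ 2 := by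
  have hδ0 : 0 ≤ δ := (norm_nonneg _).trans (hv2 (emb y))
  have hδ2 : δ ≤ 1 / 2 := by linarith
  have hcard : (0 : ℝ) < Fintype.card (Idx P) := Nat.cast_pos.2 Fintype.card_pos
  have ha : ∀ i : Idx P, ‖((holT (emlIterU k U₀) (emb y) (stairWord i.2.1 (off i.1)) * frameAccU k U₀ W (transl (emb y) (disp (stairWord i.2.1 (off i.1))))
          * (holT (emlIterU k U₀) (emb y) (stairWord i.2.1 (off i.1)))⁻¹ : 𝔸ˣ) : 𝔸)‖ ≤ 1 :=
    fun i => norm_conj_le_one _ _ (hν y i).1 (hν y i).2 (hv1 _)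
  have ha1 : ∀ i : Idx P, ‖((holT (emlIterU k U₀) (emb y) (stairWord i.2.1 (off i.1)) * frameAccU k U₀ W (transl (emb y) (disp (stairWord i.2.1 (off i.1))))
          * (holT (emlIterU k U₀) (emb y) (stairWord i.2.1 (off i.1)))⁻¹ : 𝔸ˣ) : 𝔸) - 1‖ ≤ δ :=
    fun i => (norm_conj_sub_one_le _ _ (hν y i).1 (hν y i).2).trans (hv2 _)
  have htst : ∀ i : Idx P, ‖((tstairU (emlIterU k U₀) (dbarCovIterU k U₀ W) y i : 𝔸ˣ) : 𝔸) - 1‖ ≤ ρ + 3 * δ :=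
    fun i => norm_tstairU_sub_one_le_sup k U₀ W hδ2 hv1 hv1' hν hv2 hR y i
  have hB1 := norm_frameAccU_succ_sub_one_le k U₀ W y (hv1 _) ha htst ht
  have hmean : (Fintype.card (Idx P) : ℝ)⁻¹ * ∑ i : Idx P,
      (‖((holT (emlIterU k W) (emb y) (stairWord i.2.1 (off i.1)) * (holT (emlIterU k U₀) (emb y) (stairWord i.2.1 (off i.1)))⁻¹ : 𝔸ˣ) : 𝔸) - 1‖
        + ‖((holT (emlIterU k U₀) (emb y) (stairWord i.2.1 (off i.1)) * frameAccU k U₀ W (transl (emb y) (disp (stairWord i.2.1 (off i.1))))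
            * (holT (emlIterU k U₀) (emb y) (stairWord i.2.1 (off i.1)))⁻¹ : 𝔸ˣ) : 𝔸) - 1‖) ≤ ρ + δ := by
    calc (Fintype.card (Idx P) : ℝ)⁻¹ * ∑ i : Idx P,
        (‖((holT (emlIterU k W) (emb y) (stairWord i.2.1 (off i.1)) * (holT (emlIterU k U₀) (emb y) (stairWord i.2.1 (off i.1)))⁻¹ : 𝔸ˣ) : 𝔸) - 1‖
          + ‖((holT (emlIterU k U₀) (emb y) (stairWord i.2.1 (off i.1)) * frameAccU k U₀ W (transl (emb y) (disp (stairWord i.2.1 (off i.1))))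
              * (holT (emlIterU k U₀) (emb y) (stairWord i.2.1 (off i.1)))⁻¹ : 𝔸ˣ) : 𝔸) - 1‖)
        ≤ (Fintype.card (Idx P) : ℝ)⁻¹ * ∑ _i : Idx P, (ρ + δ) :=
          mul_le_mul_of_nonneg_left (Finset.sum_le_sum fun i _ => add_le_add (hR y i) (ha1 i)) (by positivity)
      _ = ρ + δ := by rw [Finset.sum_const, Finset.card_univ, nsmul_eq_mul, ← mul_assoc, inv_mul_cancel₀ hcard.ne', one_mul]
  linarith

/-! ## §3 The real bookkeeping of the sup induction: the invariant `δ_k ≤ 2ρ_k` survives one step when the source grows geometrically -/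

/-- **THE SUP INVARIANT SURVIVES ONE STEP**: `0 ≤ ρ`, `294ρ ≤ 1`, `0 ≤ δ ≤ 2ρ`, `2ρ ≤ ρ′` ⟹ `ρ + δ + 6(ρ + 3δ)² ≤ 2ρ′` and the window `ρ + 3δ ≤ ¼` holds. [folklore] -/
theorem supStep_le (ρ ρ' δ : ℝ) (hρ : 0 ≤ ρ) (hρs : 294 * ρ ≤ 1) (hδ0 : 0 ≤ δ) (hδ : δ ≤ 2 * ρ) (hρ' : 2 * ρ ≤ ρ') :
    ρ + δ + 6 * (ρ + 3 * δ) ^ 2 ≤ 2 * ρ' ∧ ρ + 3 * δ ≤ 1 / 4 := by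
  have h7 : ρ + 3 * δ ≤ 7 * ρ := by linarith
  have hsq : (ρ + 3 * δ) ^ 2 ≤ (7 * ρ) ^ 2 := pow_le_pow_left₀ (by positivity) h7 2
  constructor
  · nlinarith
  · nlinarith

/-- **THE SUP INDUCTION** (reals): `δ₀ = 0`, `δ_{j+1} ≤ ρ_j + δ_j + 6(ρ_j + 3δ_j)²` whenever the window `ρ_j + 3δ_j ≤ ¼` holds, a non-negative source with `2ρ_j ≤ ρ_{j+1}` and
`294ρ_j ≤ 1` ⟹ `δ_j ≤ 2ρ_j` for every `j ≤ k`. [cite: Balaban1985Averaging, (97) p.32, Prop. 3 (122)-(126) p.36] -/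
theorem frameSup_induction (k : ℕ) (ρ δ : ℕ → ℝ) (hρ0 : ∀ j ≤ k, 0 ≤ ρ j) (hρ2 : ∀ j < k, 2 * ρ j ≤ ρ (j + 1)) (hρs : ∀ j < k, 294 * ρ j ≤ 1)
    (hδ00 : ∀ j ≤ k, 0 ≤ δ j) (hδ0 : δ 0 = 0) (hδ : ∀ j < k, ρ j + 3 * δ j ≤ 1 / 4 → δ (j + 1) ≤ ρ j + δ j + 6 * (ρ j + 3 * δ j) ^ 2) :
    ∀ j ≤ k, δ j ≤ 2 * ρ j := by
  intro j
  induction j with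
  | zero => intro hj; rw [hδ0]; linarith [hρ0 0 hj]
  | succ j ih =>
    intro hj
    have hj' : j < k := Nat.lt_of_succ_le hj
    have hdj := ih hj'.le
    obtain ⟨h1, h2⟩ := supStep_le (ρ j) (ρ (j + 1)) (δ j) (hρ0 j hj'.le) (hρs j hj') (hδ00 j hj'.le) hdj (hρ2 j hj')
    exact (hδ j hj' h2).trans h1

end Summit.QuantumFields.YangMills.Theorems.Prop7TwistedLinkFrameSup

end
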